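import Mathlib
import HarnessLib
import Summits.HubbardSuperconductivity.HubbardSuperconductivity.Theorems.KLProgrammeKLRegimeSplitSlotsV17F2
import Summits.HubbardSuperconductivity.HubbardSuperconductivity.Theorems.KLProgrammeKLRegimeSplitChildOneClosers
import Summits.HubbardSuperconductivity.HubbardSuperconductivity.Theorems.KLProgrammeKLRegimeSplitChildOneClosersS2

/-!
# Route `KLProgramme` — crux K3 gen 8, CHILD 1 `KLRegimeBetaSplitV17F2` (stmt-HubbardSuperconductivity-20438): the PER-SCALE child-1 step on the scheme-F texts
# (`…SplitSlotsV17F` §2, p2 g10): (B1-F) `PairArrayAtV17F n` + (E5-F) `IsoTupleL1AtV17F n` + (E4) `EngineFirstMoments … (K_n) n` ⟹ `BetaSplitAtV17F n`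

Cell gate-hubbard-kl, seat hubbard-kl-k3c1-p1 (g8; child-1 lineage).  Twin of `betaSplitAtS2_of_pairArrayAtV2` (`…SplitChildOneStepS2`, p1) and of k3c1-p2's Wick twin
`betaSplitAtW_of_pairArrayAtW` (`…SplitChildOneStepW`, p490192) with the frame `K ↦ K_n := klFlowFrameU L M β U μ n` in the OBJECTS and the reading ball
`klBall L μ K ↦ klBall L μ 0` (the bare-frame ball of the F texts, condition (α) of k3c1-p2's CHILD1-FLOW-PORT.md): the value/amplitude identity `klQuarticValue_pair` is
pointwise (any frame, any momenta), the (E5-F) clause `IsoTupleL1AtV17F` quantifies its value hypothesis over the SAME bare ball and concludes at `K_n`, and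
`klIsoKernelAt_self` / `firstMoments_of_engineFirstMoments` are frame-generic — so the step is the S2 step token for token.  **`quarticValue_pair_le_of_pairArrayAtV17F`**,
**`quarticValueF_le_of_pairArrayAtV17F`**, **`quarticValueLineV17F_of_pairArrayAtV17F`**, **`endpointNormLineIso_of_pairArrayAtV17F`**, **`betaSplitAtV17F_of_pairArrayAtV17F`**.
Everything is proved; no definitions; nothing about the model is asserted (the hypotheses are engine/row-0′ outputs); nothing asserts superconductivity.
-/

noncomputable section

namespace Summit.HubbardSuperconductivity.HubbardSuperconductivity.Theorems.KLRegimeSplit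

set_option linter.dupNamespace false -- summit = problem name (single-conjunct summit), D-0017

open Real Literature.MathematicalPhysics.QuantumLattice Literature.Probability.LatticeModels

section Model

variable (L M : ℕ) [NeZero L] [NeZero M]

/-- **Pair-class `(0,1)` values at the flow frame from (B1-F)**: `PairArrayAtV17F n` gives `‖λₙ^{↑↓}[K_n](k′, k, Q−k′)‖ ≤ 2|U| + (C_W + κ₀·CR·Klam³)·U²` for `k, k′`
in the bare ball (twin of `quarticValue_pair_le_of_pairArrayAtV2`). -/
theorem quarticValue_pair_le_of_pairArrayAtV17F (P : SplitConsts) (Q : EngConsts) {β U μ : ℝ} {n : ℕ}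
    (h : PairArrayAtV17F L M P Q β U μ n) (Qm : TorusSite 2 L) {k k' : TorusSite 2 L} (hk : k ∈ klBall L μ 0)
    (hk' : k' ∈ klBall L μ 0) :
    ‖klQuarticValue L M β U μ (klFlowFrameU L M β U μ n) n 0 1 k' k (Qm - k')‖ ≤ 2 * |U| + (P.C_W + klLegKappa * Q.CR * P.Klam ^ 3) * U ^ 2 := by
  obtain ⟨u, hu0, hu2, hdev⟩ := h Qm
  rw [klQuarticValue_pair]
  have hd := hdev k hk k' hk'
  calc ‖klPairAmplitude L M β U μ (klFlowFrameU L M β U μ n) n Qm k k'‖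
      = ‖(klPairAmplitude L M β U μ (klFlowFrameU L M β U μ n) n Qm k k' - (u : ℂ)) + (u : ℂ)‖ := by rw [sub_add_cancel]
    _ ≤ ‖klPairAmplitude L M β U μ (klFlowFrameU L M β U μ n) n Qm k k' - (u : ℂ)‖ + ‖(u : ℂ)‖ := norm_add_le _ _
    _ ≤ (P.C_W + klLegKappa * Q.CR * P.Klam ^ 3) * U ^ 2 + 2 * |U| := by
        rw [Complex.norm_real, Real.norm_eq_abs, abs_of_nonneg hu0]; exact add_le_add hd hu2
    _ = 2 * |U| + (P.C_W + klLegKappa * Q.CR * P.Klam ^ 3) * U ^ 2 := by ring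

/-- **`(0,1)` values at the flow frame at `(k₁, k₂, k₃)` with `k₁, k₂` in the bare ball (any `k₃`)** from `PairArrayAtV17F n` (twin of
`quarticValueS2_le_of_pairArrayAtV2`). -/
theorem quarticValueF_le_of_pairArrayAtV17F (P : SplitConsts) (Q : EngConsts) {β U μ : ℝ} {n : ℕ}
    (h : PairArrayAtV17F L M P Q β U μ n) {k₁ k₂ : TorusSite 2 L} (hk₁ : k₁ ∈ klBall L μ 0) (hk₂ : k₂ ∈ klBall L μ 0)
    (k₃ : TorusSite 2 L) :
    ‖klQuarticValue L M β U μ (klFlowFrameU L M β U μ n) n 0 1 k₁ k₂ k₃‖ ≤ 2 * |U| + (P.C_W + klLegKappa * Q.CR * P.Klam ^ 3) * U ^ 2 := by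
  have hk₃ : k₃ = (k₁ + k₃) - k₁ := by abel
  rw [hk₃]
  exact quarticValue_pair_le_of_pairArrayAtV17F L M P Q h (k₁ + k₃) hk₂ hk₁

/-- **The `(0,1)` value line on the bare ball (`QuarticValueLineV17F`) from (B1-F) alone** (given `2|U| + (C_W + κ₀·CR·Klam³)U² ≤ Klam·|U|`). -/
theorem quarticValueLineV17F_of_pairArrayAtV17F (P : SplitConsts) (Q : EngConsts) {β U μ : ℝ} {n : ℕ}
    (h : PairArrayAtV17F L M P Q β U μ n) (hK : 2 * |U| + (P.C_W + klLegKappa * Q.CR * P.Klam ^ 3) * U ^ 2 ≤ P.Klam * |U|) :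
    QuarticValueLineV17F L M P β U μ n :=
  fun _ hk₁ _ hk₂ k₃ _ => (quarticValueF_le_of_pairArrayAtV17F L M P Q h hk₁ hk₂ k₃).trans hK

/-- **(B2-iso at `K_n`) ⇐ (B1-F) + (E5-F)**: with `B₂ := 2|U| + (C_W + κ₀·CR·Klam³)U²`, if `0 ≤ B₂` and `CF·B₂ + CF·(Klam U)² ≤ Klam·|U|`, then
`PairArrayAtV17F n ∧ IsoTupleL1AtV17F n` give `EndpointNormLineIso … (K_n) n` (twin of `endpointLineS_of_V2`'s first conjunct; the (E5-F) clause reads its value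
hypothesis on the bare ball and concludes at `K_n`, read at the scale's own resolution by `klIsoKernelAt_self`). -/
theorem endpointNormLineIso_of_pairArrayAtV17F {G : GeoConsts} (P : SplitConsts) (Q : EngConsts) {β U μ : ℝ} {n : ℕ}
    (hU : 0 ≤ 2 * |U| + (P.C_W + klLegKappa * Q.CR * P.Klam ^ 3) * U ^ 2)
    (hpair : PairArrayAtV17F L M P Q β U μ n) (hiso : IsoTupleL1AtV17F L M G P β U μ n)
    (harith : G.CF * (2 * |U| + (P.C_W + klLegKappa * Q.CR * P.Klam ^ 3) * U ^ 2) + G.CF * (P.Klam * U) ^ 2 ≤ P.Klam * |U|) :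
    EndpointNormLineIso L M P β U μ (klFlowFrameU L M β U μ n) n := by
  intro Ω hΩ x₁
  have h' := hiso (2 * |U| + (P.C_W + klLegKappa * Q.CR * P.Klam ^ 3) * U ^ 2) hU
    (fun k₁ hk₁ k₂ hk₂ k₃ _ => quarticValueF_le_of_pairArrayAtV17F L M P Q hpair hk₁ hk₂ k₃) n le_rfl Ω hΩ x₁
  rw [klIsoKernelAt_self] at h'
  exact h'.trans harith

/-- **The per-scale child-1 step on the scheme-F texts** (twin of `betaSplitAtS2_of_pairArrayAtV2`): (B1-F) `PairArrayAtV17F n`, (E5-F) `IsoTupleL1AtV17F n` and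
(E4) `EngineFirstMoments … (K_n) n` give `BetaSplitAtV17F n` under the side conditions `CF·B₂ + CF·(Klam U)² ≤ Klam|U|`, `B₂ ≤ Klam|U|`, `cE4 + cE4′|U| ≤ Cd`
(`B₂ := 2|U| + (C_W + κ₀·CR·Klam³)·U²`, `0 ≤ B₂`, `0 ≤ Klam`).  `G` enters only through (E5-F)/(E4). -/
theorem betaSplitAtV17F_of_pairArrayAtV17F {G : GeoConsts} (P : SplitConsts) (Q : EngConsts) {β U μ : ℝ} {n : ℕ}
    (hU : 0 ≤ 2 * |U| + (P.C_W + klLegKappa * Q.CR * P.Klam ^ 3) * U ^ 2) (hP : 0 ≤ P.Klam)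
    (hpair : PairArrayAtV17F L M P Q β U μ n) (hiso : IsoTupleL1AtV17F L M G P β U μ n)
    (hE4 : EngineFirstMoments L M G P Q β U μ (klFlowFrameU L M β U μ n) n)
    (harith : G.CF * (2 * |U| + (P.C_W + klLegKappa * Q.CR * P.Klam ^ 3) * U ^ 2) + G.CF * (P.Klam * U) ^ 2 ≤ P.Klam * |U|)
    (hK : 2 * |U| + (P.C_W + klLegKappa * Q.CR * P.Klam ^ 3) * U ^ 2 ≤ P.Klam * |U|) (hCd : G.cE4 + Q.cE4 * |U| ≤ P.Cd) :
    BetaSplitAtV17F L M G P Q β U μ n :=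
  ⟨hpair, ⟨endpointNormLineIso_of_pairArrayAtV17F L M P Q hU hpair hiso harith, quarticValueLineV17F_of_pairArrayAtV17F L M P Q hpair hK⟩,
    firstMoments_of_engineFirstMoments L M hP hCd hE4⟩

end Model

end Summit.HubbardSuperconductivity.HubbardSuperconductivity.Theorems.KLRegimeSplit

end
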